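import Summits.Parity.GeneralizedHardyLittlewood.Theorems.FordMaynardNoSieveConst0164NegWitness0164LargeClause

/-!
# Route `FordMaynardNoSieveConst0164`, crux `NegWitness0164` (stmt-Parity-19102), line `birth`,
# stub `stub_tweakNeg0164`: the (fsl) families with three or more small coordinates vanish

Helper file toward the certificate stub (K. Ford, J. Maynard, *On the theory of prime producing sieves*,
arXiv:2407.14368, §8, proof of Theorem 2.7 (c): "We have `f_{3,1}(β, α) = 0`, since in the support of `f_{5,0}`,
the sum of any two variables is `< 1/2`. Thus, it remains to show `f_{1,1}(1-α,α) ≥ -1` and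
`f_{2,1}(β₁,β₂,α) ≥ -1`").  For raw data `F₀` supported on `{ξᵢ ≥ 41/250, Σ ξ = 1}` whose five-dimensional
part vanishes at vectors with two components summing to `≥ 1/2` and whose six-dimensional part is zero (the
shape of every witness considered: Ford–Maynard's §8 ansatz and the cell's LP class R):

* `families_high_eq_zero_0164` — for `s ≥ 3` small coordinates `b` and `α = 1 - |b| ≥ 1/2` every term of the
  family `∑_{n=2}^{6} ∫_{Δ_n(α)} 𝟙[v ≥ 41/250] w_n(v) F₀(v, b) dv` vanishes (dimension `n + s ≥ 7` carries no
  support; `(n, s) = (2, 3)` puts the pair `v₀ + v₁ = α ≥ 1/2` into `F₀⁽⁵⁾`; `n + s = 6` meets `F₀⁽⁶⁾ = 0`);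
* `families_of_one_two_0164` — hence hypothesis (iv) of `stub_tweakNeg0164_of_families` (`…LargeClause`)
  reduces to its two members `s = 1` (`f_{1,1}(1-α, α) ≥ -1`) and `s = 2` (`f_{2,1}(β₁, β₂, α) ≥ -1`).

Def-free.  References: [FordMaynard2024PrimeSieves] arXiv:2407.14368, §8 (proof of Theorem 2.7 (c)).
-/

noncomputable section

open Finset MeasureTheory
open scoped Classical
open Literature.Combinatorics.Enumerative
open Literature.NumberTheory.Sieve Literature.NumberTheory.Sieve.FordMaynard

namespace Summit.Parity.GeneralizedHardyLittlewood.FordMaynardNoSieveConst0164NegWitness0164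

/-- Data supported on `{ξᵢ ≥ 41/250, Σ ξ = 1}` vanish in every dimension `≥ 7` (`7 · 41/250 > 1`).
[cite: FordMaynard2024PrimeSieves, §6 (remark after Definition 6.2)] -/
theorem apply_eq_zero_of_seven_le_0164 {F₀ : VecFn}
    (hsupp : ∀ (k : ℕ) (ξ : Fin k → ℝ), F₀ k ξ ≠ 0 → (∀ i, (41 / 250 : ℝ) ≤ ξ i) ∧ ∑ i, ξ i = 1)
    {k : ℕ} (hk : 7 ≤ k) (ξ : Fin k → ℝ) : F₀ k ξ = 0 := by
  by_contra h
  obtain ⟨hge, hsum⟩ := hsupp k ξ h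
  have hle : (k : ℝ) * (41 / 250) ≤ ∑ i, ξ i := by
    calc (k : ℝ) * (41 / 250) = ∑ _i : Fin k, (41 / 250 : ℝ) := by simp
      _ ≤ ∑ i, ξ i := Finset.sum_le_sum fun i _ => hge i
  rw [hsum] at hle
  have hk' : (7 : ℝ) ≤ k := by exact_mod_cast hk
  linarith

/-- **The families with `s ≥ 3` small coordinates vanish termwise.** For `F₀` supported on
`{ξᵢ ≥ 41/250, Σ ξ = 1}` with `F₀⁽⁵⁾ = 0` at vectors having two components with sum `≥ 1/2` and `F₀⁽⁶⁾ = 0`: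
for `s ≥ 3`, `b ∈ ℝ^s` and `α = 1 - |b| ≥ 1/2`,
`∑_{n=2}^{6} ∫_{v ∈ Δ_n(α)} 𝟙[v ≥ 41/250] w_n(v) F₀(v, b) dv = 0`
("`f_{3,1}(β, α) = 0`, since in the support of `f_{5,0}` the sum of any two variables is `< 1/2`").
[cite: FordMaynard2024PrimeSieves, §8 (proof of Theorem 2.7 (c))] -/
theorem families_high_eq_zero_0164 {F₀ : VecFn}
    (hsupp : ∀ (k : ℕ) (ξ : Fin k → ℝ), F₀ k ξ ≠ 0 → (∀ i, (41 / 250 : ℝ) ≤ ξ i) ∧ ∑ i, ξ i = 1)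
    (hpair : ∀ (x : Fin 5 → ℝ) (i j : Fin 5), i ≠ j → 1 / 2 ≤ x i + x j → F₀ 5 x = 0)
    (h6 : ∀ x : Fin 6 → ℝ, F₀ 6 x = 0) {s : ℕ} (hs3 : 3 ≤ s) (b : Fin s → ℝ)
    (hα : ∑ i, b i ≤ 1 / 2) :
    ∑ n ∈ Finset.Icc 2 6, sliceIntegral n (1 - ∑ i, b i)
        (fun v => if ∀ t, (41 / 250 : ℝ) ≤ v t then
          blockWeight (1 / 2) n v * F₀ (n + s) (Fin.append v b) else 0) = 0 := by
  refine Finset.sum_eq_zero fun n hn => ?_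
  have hn2 : 2 ≤ n := (Finset.mem_Icc.1 hn).1
  rw [sliceIntegral_congr (G' := fun _ => 0) (fun v hv hsum => ?_), sliceIntegral_zero]
  suffices hz : F₀ (n + s) (Fin.append v b) = 0 by rw [hz, mul_zero, ite_self]
  by_cases h7 : 7 ≤ n + s
  · exact apply_eq_zero_of_seven_le_0164 hsupp h7 _
  · by_cases h6' : n + s = 6
    · rw [VecFn.apply_congr F₀ h6' (Fin.append v b) (Fin.append v b ∘ Fin.cast h6'.symm) fun i =>
        congrArg (Fin.append v b) (Fin.ext rfl)]
      exact h6 _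
    · -- `n + s = 5` with `s ≥ 3`, `n ≥ 2`: `n = 2`, `s = 3`, and `v₀ + v₁ = α ≥ 1/2`
      obtain rfl : n = 2 := by omega
      obtain rfl : s = 3 := by omega
      rw [Fin.sum_univ_two] at hsum
      refine hpair (Fin.append v b) (Fin.castAdd 3 0) (Fin.castAdd 3 1) (by decide) ?_
      rw [Fin.append_left, Fin.append_left]
      linarith

/-- **Hypothesis (iv) of `stub_tweakNeg0164_of_families` from its members `s = 1, 2`.** For `F₀` as in
`families_high_eq_zero_0164`, the five (fsl) families are `≥ -1` as soon as
`f_{1,1}(1 - α, α) ≥ -1` (`s = 1`) and `f_{2,1}(β₁, β₂, α) ≥ -1` (`s = 2`) hold.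
[cite: FordMaynard2024PrimeSieves, §8 (proof of Theorem 2.7 (c): "it remains to show f_{1,1} ≥ -1 and f_{2,1} ≥ -1")] -/
theorem families_of_one_two_0164 {F₀ : VecFn}
    (hsupp : ∀ (k : ℕ) (ξ : Fin k → ℝ), F₀ k ξ ≠ 0 → (∀ i, (41 / 250 : ℝ) ≤ ξ i) ∧ ∑ i, ξ i = 1)
    (hpair : ∀ (x : Fin 5 → ℝ) (i j : Fin 5), i ≠ j → 1 / 2 ≤ x i + x j → F₀ 5 x = 0)
    (h6 : ∀ x : Fin 6 → ℝ, F₀ 6 x = 0)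
    (h1 : ∀ b : Fin 1 → ℝ, (∀ i, (41 / 250 : ℝ) ≤ b i) → (∀ i, b i < 1 / 2) → ∑ i, b i ≤ 1 / 2 →
      -1 ≤ (1 - ∑ i, b i) * ∑ n ∈ Finset.Icc 2 6, sliceIntegral n (1 - ∑ i, b i)
        (fun v => if ∀ t, (41 / 250 : ℝ) ≤ v t then
          blockWeight (1 / 2) n v * F₀ (n + 1) (Fin.append v b) else 0))
    (h2 : ∀ b : Fin 2 → ℝ, (∀ i, (41 / 250 : ℝ) ≤ b i) → (∀ i, b i < 1 / 2) → ∑ i, b i ≤ 1 / 2 →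
      -1 ≤ (1 - ∑ i, b i) * ∑ n ∈ Finset.Icc 2 6, sliceIntegral n (1 - ∑ i, b i)
        (fun v => if ∀ t, (41 / 250 : ℝ) ≤ v t then
          blockWeight (1 / 2) n v * F₀ (n + 2) (Fin.append v b) else 0)) :
    ∀ s : ℕ, 1 ≤ s → s ≤ 5 → ∀ b : Fin s → ℝ, (∀ i, (41 / 250 : ℝ) ≤ b i) → (∀ i, b i < 1 / 2) →
      ∑ i, b i ≤ 1 / 2 →
      -1 ≤ (1 - ∑ i, b i) * ∑ n ∈ Finset.Icc 2 6, sliceIntegral n (1 - ∑ i, b i)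
        (fun v => if ∀ t, (41 / 250 : ℝ) ≤ v t then
          blockWeight (1 / 2) n v * F₀ (n + s) (Fin.append v b) else 0) := by
  intro s hs1 hs5 b hb hb' hbs
  by_cases hs3 : 3 ≤ s
  · rw [families_high_eq_zero_0164 hsupp hpair h6 hs3 b hbs, mul_zero]
    norm_num
  · interval_cases s
    · exact h1 b hb hb' hbs
    · exact h2 b hb hb' hbs

/-- **`stub_tweakNeg0164` for witnesses of the Ford–Maynard / class-R shape.** Let `F₀ ∈ 𝒮` be piecewise
Lipschitz in each dimension, supported on `{ξᵢ ≥ 41/250, Σ ξ = 1}`, with `F₀⁽⁵⁾ = 0` at vectors having two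
components with sum `≥ 1/2` and `F₀⁽⁶⁾ = 0`. If (i) `T₃(F₀) + S₅(F₀) < -1`, (ii) `F₀ ≥ -1` at the small vectors
of the support, (iii) `fragOp (1/2) (41/250) F₀ (1/2, 1/2) ≥ -1`, (iv₁) `f_{1,1}(1-α, α) ≥ -1` and
(iv₂) `f_{2,1}(β₁, β₂, α) ≥ -1`, then `F₀` witnesses `stub_tweakNeg0164` (statement verbatim).
[cite: FordMaynard2024PrimeSieves, §8 (proof of Theorem 2.7 (c))] -/
theorem stub_tweakNeg0164_of_shape (F₀ : VecFn) (hs : F₀.IsSymmetric)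
    (hpl : ∀ k, IsPiecewiseLipschitz (F₀ k))
    (hsupp : ∀ (k : ℕ) (ξ : Fin k → ℝ), F₀ k ξ ≠ 0 → (∀ i, (41 / 250 : ℝ) ≤ ξ i) ∧ ∑ i, ξ i = 1)
    (hpair : ∀ (x : Fin 5 → ℝ) (i j : Fin 5), i ≠ j → 1 / 2 ≤ x i + x j → F₀ 5 x = 0)
    (h6 : ∀ x : Fin 6 → ℝ, F₀ 6 x = 0)
    (hone : sliceIntegral 3 1 (fun v => if (∀ t, (41 / 250 : ℝ) ≤ v t) ∧ (∀ t, v t < 1 / 2) then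
          F₀ 3 v / (3 * (v 0 * v 1 * v 2)) else 0) +
        sliceIntegral 5 1
          (fun v => if ∀ t, (41 / 250 : ℝ) ≤ v t then blockWeight (1 / 2) 5 v * F₀ 5 v else 0) < -1)
    (hsmall : ∀ (k : ℕ) (ξ : Fin k → ℝ), (∀ i, (41 / 250 : ℝ) ≤ ξ i) → (∀ i, ξ i < 1 / 2) →
      ∑ i, ξ i = 1 → -1 ≤ F₀ k ξ)
    (hhalf : -1 ≤ fragOp (1 / 2) (41 / 250) F₀ 2 (fun _ => 1 / 2))
    (h1 : ∀ b : Fin 1 → ℝ, (∀ i, (41 / 250 : ℝ) ≤ b i) → (∀ i, b i < 1 / 2) → ∑ i, b i ≤ 1 / 2 →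
      -1 ≤ (1 - ∑ i, b i) * ∑ n ∈ Finset.Icc 2 6, sliceIntegral n (1 - ∑ i, b i)
        (fun v => if ∀ t, (41 / 250 : ℝ) ≤ v t then
          blockWeight (1 / 2) n v * F₀ (n + 1) (Fin.append v b) else 0))
    (h2 : ∀ b : Fin 2 → ℝ, (∀ i, (41 / 250 : ℝ) ≤ b i) → (∀ i, b i < 1 / 2) → ∑ i, b i ≤ 1 / 2 →
      -1 ≤ (1 - ∑ i, b i) * ∑ n ∈ Finset.Icc 2 6, sliceIntegral n (1 - ∑ i, b i)
        (fun v => if ∀ t, (41 / 250 : ℝ) ≤ v t then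
          blockWeight (1 / 2) n v * F₀ (n + 2) (Fin.append v b) else 0)) :
    ∃ F₀ : VecFn, F₀.IsSymmetric ∧ (∀ k, IsPiecewiseLipschitz (F₀ k)) ∧
      (∀ (k : ℕ) (ξ : Fin k → ℝ), F₀ k ξ ≠ 0 → (∀ i, (41 / 250 : ℝ) ≤ ξ i) ∧ ∑ i, ξ i = 1) ∧
      tweak (1 / 2) (41 / 250) Fin.elim0 Fin.elim0 F₀ 1 (fun _ => 1) < -1 ∧
      ∀ k : ℕ, 2 ≤ k → ∀ β : Fin k → ℝ, -1 ≤ tweak (1 / 2) (41 / 250) Fin.elim0 Fin.elim0 F₀ k β := by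
  refine stub_tweakNeg0164_of_families F₀ hs hpl hsupp ?_ hsmall hhalf
    (families_of_one_two_0164 hsupp hpair h6 h1 h2)
  have hS6 : sliceIntegral 6 1
      (fun v => if ∀ t, (41 / 250 : ℝ) ≤ v t then blockWeight (1 / 2) 6 v * F₀ 6 v else 0) = 0 := by
    rw [sliceIntegral_congr (G' := fun _ => 0) (fun v _ _ => by rw [h6 v, mul_zero, ite_self]),
      sliceIntegral_zero]
  rw [hS6, add_zero]
  exact hone

end Summit.Parity.GeneralizedHardyLittlewood.FordMaynardNoSieveConst0164NegWitness0164

end
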